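import Summits.CriticalPhenomena.PercolationContinuityZ3.Theorems.PercNearOneGluingAdditiveGluingFingerLeaves
import Summits.CriticalPhenomena.PercolationContinuityZ3.Theorems.PercNearOneGluingAdditiveGluingFingerTwoTouchedB
import HarnessLib

/-! # Crux `PercNearOneGluing.AdditiveGluing` (stmt-CriticalPhenomena-4576) — the finger multi-edge Lemma 3 (`stub_fingerML3_vp`):
# the generic LEAF-STRIPPING reduction, and the class "fingers touching ≤ 2 relays + leaves" (seat (b) V⁺-form, `png-dp-vplus`, gen 8)

Support file (`--supports stmt-CriticalPhenomena-4576`); no definitions, no named facts, no sorries.  Companion of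
`…AdditiveGluingFingerLeaves.lean` (`fingerML3_hub_leaves`, `fingerML3_peel_pair_self`).

Setting of `stub_fingerML3_vp`: weighting `K` on `Fin n`, relays `A ∋ b, d`, block `N` disjoint from `A`, glued weighting `g = K/N`,
`R` = "some pair `N–A` open", conclusion FML3(K): `μ_g(R ∩ {d↔b}) ≤ μ_g(R ∩ ⋃_{v∈N}{v↔b})`, hypothesis `μ_K(d↔b) ≤ μ_K(a↔b)` (`a ∈ A`).
A LEAF is a block vertex `ℓ` with at most one positive pair, `s(ℓ, c)` for a relay `c ∈ A`.

* `fingerML3_strip_leaves` — **leaf stripping**: let `L ⊆ N` consist of leaves and let `K₀` be `K` with every pair `L–A` killed.  If the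
  conclusion FML3(K₀) holds GIVEN the stub's hypothesis for `K₀` (which is the hypothesis for `K`: killing the pair of a pendant vertex changes
  no two-point function off that vertex, `al5_pendant_real_openConn`), then FML3(K) holds.  Induction on the positive leaf pairs, each step
  `fingerML3_peel_pair` (Kozma–Nitzan Lemma 3(ii) at the leaf's relay) or `fingerML3_peel_pair_self` (leaf at `d`).  In the K-world set form
  of the stub this is the identity `margin(K) = Σ_J w_J·m_J` over the patterns `J` of open leaf pairs, `m_∅ = margin(K₀)` and, for `J ≠ ∅`,
  `m_J = μ_{K₀}(N ∪ C_J ↔ b) − μ_{K₀/(N∪C_J)}(d↔b) ≥ 0` by one application of Lemma 3(ii) (memo MEMO-gen8 §3, run/shared/lean/prim/prim-png-dp-vplus/).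
* `fingerML3_twoTouched_leaves` — **`stub_fingerML3_vp` when every relay other than two (`w₁, w₂`, one may be `b`) is touched only by
  leaves** (fingers pairwise non-adjacent), any `A`: `fingerML3_strip_leaves` + `fingerML3_twoTouched_withB` on `K₀` (the killed leaves are
  inert block vertices, which that theorem allows).  Together with `fingerML3_hub_leaves` this settles, inside the crux's open family
  ("≥ 3 contact relays"), e.g. the touch patterns `[{1,2},{3}]`, `[{1,2},{1,2},{3},{4}]`, `[{b,1},{2},{3}]`, `[{1,2,3},{1},{3}]`.
[cite: KozmaNitzan2024, Lemma 3(i)–(ii) (pp. 6–7), Lemma 5 and Thm 4 (§3.2, pp. 12–14)]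
-/

namespace Summit.CriticalPhenomena.PercolationContinuityZ3.Theorems

open MeasureTheory Set
open Literature.Probability.LatticeModels (prodBernoulli)
open Literature.Probability.Percolation (BondConfig openConn openGraph pinW)

noncomputable section
open Classical

section FingerLeavesStrip

open Literature.Probability.LatticeModels Literature.Probability.Percolation

variable {n : ℕ}

/-- **Leaf stripping.**  Stub setting (`b, d ∈ A`, `Disjoint N A`, `μ_K(d↔b) ≤ μ_K(a↔b)` on `A`); `L ⊆ N` a set of leaves (each `ℓ ∈ L`
has, for some relay `c ∈ A`, weight `0` on every pair `s(ℓ, y)`, `y ∉ {c, ℓ}`); `K₀` = `K` with all pairs `L–A` killed.  If the stub's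
hypothesis for `K₀` implies the stub's conclusion for `K₀`, then the conclusion holds for `K`.
[cite: KozmaNitzan2024, Lemma 3(ii) (pp. 6–7), §3.2 pp. 12–14] -/
theorem fingerML3_strip_leaves (K : Sym2 (Fin n) → unitInterval) (A N L : Finset (Fin n)) (d b : Fin n)
    (hb : b ∈ A) (hNA : Disjoint N A) (hd : d ∈ A) (hLN : L ⊆ N)
    (hleaf : ∀ ℓ ∈ L, ∃ c ∈ A, ∀ y : Fin n, y ≠ c → y ≠ ℓ → K s(ℓ, y) = 0)
    (hle : ∀ a ∈ A, (prodBernoulli K).real (openConn d b) ≤ (prodBernoulli K).real (openConn a b))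
    (hbase : (∀ a ∈ A,
        (prodBernoulli (fun e' : Sym2 (Fin n) => if (∃ ℓ ∈ L, ∃ a' ∈ A, e' = s(ℓ, a')) then (0 : unitInterval) else K e')).real
            (openConn d b) ≤
          (prodBernoulli (fun e' : Sym2 (Fin n) => if (∃ ℓ ∈ L, ∃ a' ∈ A, e' = s(ℓ, a')) then (0 : unitInterval) else K e')).real
            (openConn a b)) →
      (prodBernoulli (fun e' : Sym2 (Fin n) => if (∀ y ∈ e', y ∈ N) ∧ ¬ e'.IsDiag then 1 else
            if (∃ ℓ ∈ L, ∃ a' ∈ A, e' = s(ℓ, a')) then (0 : unitInterval) else K e')).real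
          ({ω : Set (Sym2 (Fin n)) | ∃ v ∈ N, ∃ a' ∈ A, s(v, a') ∈ ω} ∩ openConn d b) ≤
        (prodBernoulli (fun e' : Sym2 (Fin n) => if (∀ y ∈ e', y ∈ N) ∧ ¬ e'.IsDiag then 1 else
            if (∃ ℓ ∈ L, ∃ a' ∈ A, e' = s(ℓ, a')) then (0 : unitInterval) else K e')).real
          ({ω : Set (Sym2 (Fin n)) | ∃ v ∈ N, ∃ a' ∈ A, s(v, a') ∈ ω} ∩ ⋃ v ∈ N, openConn v b)) :
    (prodBernoulli (fun e' : Sym2 (Fin n) => if (∀ y ∈ e', y ∈ N) ∧ ¬ e'.IsDiag then 1 else K e')).real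
        ({ω : Set (Sym2 (Fin n)) | ∃ v ∈ N, ∃ a' ∈ A, s(v, a') ∈ ω} ∩ openConn d b) ≤
      (prodBernoulli (fun e' : Sym2 (Fin n) => if (∀ y ∈ e', y ∈ N) ∧ ¬ e'.IsDiag then 1 else K e')).real
        ({ω : Set (Sym2 (Fin n)) | ∃ v ∈ N, ∃ a' ∈ A, s(v, a') ∈ ω} ∩ ⋃ v ∈ N, openConn v b) := by
  set K₀ : Sym2 (Fin n) → unitInterval :=
    fun e' => if (∃ ℓ ∈ L, ∃ a' ∈ A, e' = s(ℓ, a')) then (0 : unitInterval) else K e' with hK₀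
  -- the positive leaf pairs of a weighting
  let P : (Sym2 (Fin n) → unitInterval) → Finset (Fin n × Fin n) := fun w =>
    (L ×ˢ A).filter (fun la => w s(la.1, la.2) ≠ 0)
  have hdN : d ∉ N := Finset.disjoint_left.1 hNA.symm hd
  have hbN : b ∉ N := Finset.disjoint_left.1 hNA.symm hb
  -- induction over the weightings between `K` and `K₀`
  suffices key : ∀ (m : ℕ) (w : Sym2 (Fin n) → unitInterval), (P w).card = m →
      (∀ e : Sym2 (Fin n), w e = K e ∨ (w e = 0 ∧ ∃ ℓ ∈ L, ∃ a' ∈ A, e = s(ℓ, a'))) →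
      (∀ ℓ ∈ L, ∃ c ∈ A, ∀ y : Fin n, y ≠ c → y ≠ ℓ → w s(ℓ, y) = 0) →
      (∀ a ∈ A, (prodBernoulli w).real (openConn d b) ≤ (prodBernoulli w).real (openConn a b)) →
      (prodBernoulli (fun e' : Sym2 (Fin n) => if (∀ y ∈ e', y ∈ N) ∧ ¬ e'.IsDiag then 1 else w e')).real
          ({ω : Set (Sym2 (Fin n)) | ∃ v ∈ N, ∃ a' ∈ A, s(v, a') ∈ ω} ∩ openConn d b) ≤
        (prodBernoulli (fun e' : Sym2 (Fin n) => if (∀ y ∈ e', y ∈ N) ∧ ¬ e'.IsDiag then 1 else w e')).real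
          ({ω : Set (Sym2 (Fin n)) | ∃ v ∈ N, ∃ a' ∈ A, s(v, a') ∈ ω} ∩ ⋃ v ∈ N, openConn v b) from
    key _ K rfl (fun e => Or.inl rfl) hleaf hle
  intro m
  induction m using Nat.strong_induction_on with
  | _ m ih =>
    intro w hcard hinv wleaf wle
    by_cases hP : P w = ∅
    · -- base: `w = K₀`
      have hw : w = K₀ := by
        funext e
        by_cases he : ∃ ℓ ∈ L, ∃ a' ∈ A, e = s(ℓ, a')
        · have h0 : K₀ e = 0 := by simp only [hK₀, he, if_true]
          rw [h0]
          obtain ⟨ℓ, hℓ, a', ha', rfl⟩ := he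
          by_contra hne
          have : (ℓ, a') ∈ P w := Finset.mem_filter.2 ⟨Finset.mem_product.2 ⟨hℓ, ha'⟩, hne⟩
          rw [hP] at this
          exact Finset.notMem_empty _ this
        · have h1 : K₀ e = K e := by simp only [hK₀, he, if_false]
          rw [h1]
          rcases hinv e with h | ⟨-, h⟩
          · exact h
          · exact (he h).elim
      rw [hw] at wle ⊢
      exact hbase wle
    · -- step: peel one positive leaf pair `s(ℓ, c)`
      obtain ⟨⟨ℓ, c⟩, hℓc⟩ := Finset.nonempty_iff_ne_empty.2 hP
      obtain ⟨hℓcA, hwℓc⟩ := Finset.mem_filter.1 hℓc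
      obtain ⟨hℓ, hc⟩ := Finset.mem_product.1 hℓcA
      simp only at hwℓc hc hℓ
      have hℓN : ℓ ∈ N := hLN hℓ
      have hcN : c ∉ N := Finset.disjoint_left.1 hNA.symm hc
      have hcℓ : c ≠ ℓ := fun h => hcN (h ▸ hℓN)
      -- `c` is THE contact of the leaf `ℓ`
      obtain ⟨c', hc', hcw'⟩ := wleaf ℓ hℓ
      have hcc' : c = c' := by
        by_contra hne
        exact hwℓc (hcw' c hne hcℓ)
      have hℓpend : ∀ u : Fin n, u ≠ ℓ → u ≠ c → w s(ℓ, u) = 0 := fun u hu huc => hcw' u (hcc' ▸ huc) hu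
      -- the peeled weighting
      set w' : Sym2 (Fin n) → unitInterval := fun e' => if e' = s(ℓ, c) then 0 else w e' with hw'
      have hw'le : ∀ e : Sym2 (Fin n), (w' e = 0 ∧ e = s(ℓ, c)) ∨ w' e = w e := by
        intro e
        by_cases he : e = s(ℓ, c)
        · left; exact ⟨by simp only [hw', he, if_true], he⟩
        · right; simp only [hw', he, if_false]
      -- two-point functions of vertices `≠ ℓ` are unchanged
      have htwo : ∀ v : Fin n, v ≠ ℓ → (prodBernoulli w').real (openConn v b) = (prodBernoulli w).real (openConn v b) := by
        intro v hv
        rw [hw']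
        exact (al5_pendant_real_openConn w ℓ c v b hv (fun h => hbN (h ▸ hℓN)) hcℓ hℓpend).symm
      -- the hypotheses for `w'`
      have hinv' : ∀ e : Sym2 (Fin n), w' e = K e ∨ (w' e = 0 ∧ ∃ ℓ₁ ∈ L, ∃ a' ∈ A, e = s(ℓ₁, a')) := by
        intro e
        rcases hw'le e with ⟨h0, he⟩ | h
        · exact Or.inr ⟨h0, ℓ, hℓ, c, hc, he⟩
        · rw [h]; exact hinv e
      have w'leaf : ∀ ℓ₁ ∈ L, ∃ c₁ ∈ A, ∀ y : Fin n, y ≠ c₁ → y ≠ ℓ₁ → w' s(ℓ₁, y) = 0 := by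
        intro ℓ₁ hℓ₁
        obtain ⟨c₁, hc₁, hcw₁⟩ := wleaf ℓ₁ hℓ₁
        refine ⟨c₁, hc₁, fun y hy hyℓ => ?_⟩
        rcases hw'le s(ℓ₁, y) with ⟨h, -⟩ | h
        · exact h
        · rw [h]; exact hcw₁ y hy hyℓ
      have w'le : ∀ a ∈ A, (prodBernoulli w').real (openConn d b) ≤ (prodBernoulli w').real (openConn a b) := by
        intro a ha
        rw [htwo d (fun h => hdN (h ▸ hℓN)), htwo a (fun h => (Finset.disjoint_left.1 hNA.symm ha) (h ▸ hℓN))]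
        exact wle a ha
      -- the positive leaf pairs of `w'` are those of `w` minus `(ℓ, c)`
      have hPsub : P w' ⊆ (P w).erase (ℓ, c) := by
        intro la hla
        obtain ⟨hlaA, hwla⟩ := Finset.mem_filter.1 hla
        refine Finset.mem_erase.2 ⟨?_, Finset.mem_filter.2 ⟨hlaA, ?_⟩⟩
        · rintro rfl
          exact hwla (by simp only [hw', if_true])
        · rcases hw'le s(la.1, la.2) with ⟨h, -⟩ | h
          · exact (hwla h).elim
          · rwa [h] at hwla
      have hcard' : (P w').card < m := by
        calc (P w').card ≤ ((P w).erase (ℓ, c)).card := Finset.card_le_card hPsub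
          _ < (P w).card := Finset.card_erase_lt_of_mem hℓc
          _ = m := hcard
      have hsub := ih (P w').card hcard' w' rfl hinv' w'leaf w'le
      -- peel the pair `s(ℓ, c)`
      by_cases hcd : c = d
      · subst hcd
        exact fingerML3_peel_pair_self w A N c b ℓ hNA hd hℓN hsub
      · exact fingerML3_peel_pair w A N d c b ℓ hNA hd hc (Ne.symm hcd) hℓN (wle c hc) hsub

/-- **`stub_fingerML3_vp` when all relays but two are touched only by leaves.**  Stub setting (`b, d ∈ A`, `Disjoint N A`, fingers free off
`A`, pairwise non-adjacent, `μ_K(d↔b) ≤ μ_K(a↔b)` on `A`); `L ⊆ N` leaves (each with at most one positive pair, to a relay); every block vertex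
outside `L` has weight `0` on its pairs to relays other than `w₁, w₂` (two vertices, possibly `b`).  Then
`μ_{K/N}(R ∩ {d↔b}) ≤ μ_{K/N}(R ∩ ⋃_{v∈N}{v↔b})`.  (`fingerML3_strip_leaves`, then `fingerML3_twoTouched_withB` for the leaf-killed
weighting, in which the vertices of `L` are inert.) [cite: KozmaNitzan2024, Lemma 3 (pp. 6–7), §3.2 pp. 12–14, §4 p. 20] -/
theorem fingerML3_twoTouched_leaves (K : Sym2 (Fin n) → unitInterval) (A N L : Finset (Fin n)) (d b w₁ w₂ : Fin n)
    (hb : b ∈ A) (hNA : Disjoint N A) (hd : d ∈ A) (hLN : L ⊆ N)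
    (hfree : ∀ v ∈ N, ∀ y : Fin n, y ∉ A → y ∉ N → (K s(v, y) : ℝ) = 0)
    (hle : ∀ a ∈ A, (prodBernoulli K).real (openConn d b) ≤ (prodBernoulli K).real (openConn a b))
    (hleaf : ∀ ℓ ∈ L, ∃ c ∈ A, ∀ y : Fin n, y ≠ c → y ≠ ℓ → K s(ℓ, y) = 0)
    (htwo : ∀ v ∈ N, v ∉ L → ∀ a ∈ A, a ≠ w₁ → a ≠ w₂ → (K s(v, a) : ℝ) = 0)
    (hint : ∀ v ∈ N, ∀ v' ∈ N, v ≠ v' → (K s(v, v') : ℝ) = 0) :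
    (prodBernoulli (fun e' : Sym2 (Fin n) => if (∀ y ∈ e', y ∈ N) ∧ ¬ e'.IsDiag then 1 else K e')).real
        ({ω : Set (Sym2 (Fin n)) | ∃ v ∈ N, ∃ a' ∈ A, s(v, a') ∈ ω} ∩ openConn d b) ≤
      (prodBernoulli (fun e' : Sym2 (Fin n) => if (∀ y ∈ e', y ∈ N) ∧ ¬ e'.IsDiag then 1 else K e')).real
        ({ω : Set (Sym2 (Fin n)) | ∃ v ∈ N, ∃ a' ∈ A, s(v, a') ∈ ω} ∩ ⋃ v ∈ N, openConn v b) := by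
  set K₀ : Sym2 (Fin n) → unitInterval :=
    fun e' => if (∃ ℓ ∈ L, ∃ a' ∈ A, e' = s(ℓ, a')) then (0 : unitInterval) else K e' with hK₀
  have hK₀le : ∀ e : Sym2 (Fin n), K₀ e = 0 ∨ K₀ e = K e := by
    intro e
    by_cases he : ∃ ℓ ∈ L, ∃ a' ∈ A, e = s(ℓ, a')
    · left; simp only [hK₀, he, if_true]
    · right; simp only [hK₀, he, if_false]
  refine fingerML3_strip_leaves K A N L d b hb hNA hd hLN hleaf hle fun hle₀ => ?_
  -- the hypotheses of `fingerML3_twoTouched_withB` for `K₀`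
  have hfree₀ : ∀ v ∈ N, ∀ y : Fin n, y ∉ A → y ∉ N → (K₀ s(v, y) : ℝ) = 0 := by
    intro v hv y hyA hyN
    rcases hK₀le s(v, y) with h | h
    · rw [h]; rfl
    · rw [h]; exact hfree v hv y hyA hyN
  have htwo₀ : ∀ v ∈ N, ∀ a ∈ A, a ≠ w₁ → a ≠ w₂ → (K₀ s(v, a) : ℝ) = 0 := by
    intro v hv a ha ha₁ ha₂
    by_cases hvL : v ∈ L
    · have h : K₀ s(v, a) = 0 := by
        have he : ∃ ℓ ∈ L, ∃ a' ∈ A, s(v, a) = s(ℓ, a') := ⟨v, hvL, a, ha, rfl⟩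
        simp only [hK₀, he, if_true]
      rw [h]; rfl
    · rcases hK₀le s(v, a) with h | h
      · rw [h]; rfl
      · rw [h]; exact htwo v hv hvL a ha ha₁ ha₂
  have hint₀ : ∀ v ∈ N, ∀ v' ∈ N, v ≠ v' → (K₀ s(v, v') : ℝ) = 0 := by
    intro v hv v' hv' hvv'
    rcases hK₀le s(v, v') with h | h
    · rw [h]; rfl
    · rw [h]; exact hint v hv v' hv' hvv'
  exact fingerML3_twoTouched_withB K₀ A N d b w₁ w₂ hb hNA hd hfree₀ hle₀ htwo₀ hint₀

end FingerLeavesStrip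

end

end Summit.CriticalPhenomena.PercolationContinuityZ3.Theorems
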